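import Literature.Analysis.FluidPDE.KNSSAxisymmetricNoSwirl
import Literature.Analysis.FluidPDE.SereginZajaczkowski2007SwirlRotation
import Summits.NavierStokesRegularity.NavierStokesRegularity.Theorems.AxisymmetricExtremalityPFoldToAxisymmetricDenseAngleClosure

/-!
# Route AxisymmetricExtremality — crux `PFoldToAxisymmetric`, line `birth`: Euclidean motions on `L³(EuclideanSpace ℝ (Fin 3))`

Support file (lead, stub `stub_axisPinning` of item stmt-NavierStokesRegularity-15454). Three
measure-theoretic tools about the action `u ↦ u ∘ A`, `A x = R_θ x + c`, of the vertical screw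
motions on `L³(EuclideanSpace ℝ (Fin 3); EuclideanSpace ℝ (Fin 3))` (`R_θ = rotZ θ`, the rotation about the `x 2`-axis):

* `tendsto_eLpNorm_comp_motion_sub` — strong continuity: `θ_i → θ₀`, `c_i → c₀` imply
  `‖u ∘ A_i − u ∘ A₀‖_{L³} → 0` (Mathlib's `Lp.compMeasurePreserving_continuous`);
* `tendsto_eLpNorm_rotZ_apply_sub` — continuity of the action on VALUES: `‖R_{θ_i} ∘ u − R_{θ₀} ∘ u‖_{L³} → 0`
  (the pointwise bound `norm_rotZ_sub_rotZ_le` is the one landed with stub 3, `…DenseAngleClosure`);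
* `eLpNorm_eq_zero_of_tendsto_eLpNorm_comp_motion_sub` — ESCAPE LEMMA: if `‖c_j‖ → ∞` and
  `‖u ∘ A_j − u‖_{L³} → 0` then `u = 0` in `L³` (the mass of `u` in a ball equals, up to `o(1)`,
  its mass in the far-away image ball, which tends to `0`).

All elementary (folklore); no Navier–Stokes.
-/

noncomputable section

-- single-conjunct summit: `Summit.<Summit>.<Problem>` repeats the name by the D-0017 layout
set_option linter.dupNamespace false

namespace Summit.NavierStokesRegularity.NavierStokesRegularity.Theorems.PFoldToAxisymmetric.AxisPinning

open MeasureTheory Filter Topology Set Function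
open scoped ENNReal NNReal
open Literature.Analysis.FluidPDE

/-- The screw motion `x ↦ R_θ x + c` preserves Lebesgue measure. [folklore] -/
theorem measurePreserving_motion (θ : ℝ) (c : EuclideanSpace ℝ (Fin 3)) :
    MeasurePreserving (fun x : EuclideanSpace ℝ (Fin 3) => rotZ θ x + c) volume volume :=
  (measurePreserving_add_right volume c).comp (measurePreserving_rotZ θ)

/-- **Strong continuity of the motion group on `L³`.** If `u ∈ L³(EuclideanSpace ℝ (Fin 3); EuclideanSpace ℝ (Fin 3))`, `θ_i → θ₀` and
`c_i → c₀`, then `‖u(R_{θ_i} · + c_i) − u(R_{θ₀} · + c₀)‖_{L³} → 0` (continuity of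
`Lp.compMeasurePreserving` in the measure-preserving map, Mathlib). [folklore] -/
theorem tendsto_eLpNorm_comp_motion_sub {u : EuclideanSpace ℝ (Fin 3) → EuclideanSpace ℝ (Fin 3)} (hu : MemLp u 3 volume) {ι : Type*}
    {l : Filter ι} {θ : ι → ℝ} {c : ι → EuclideanSpace ℝ (Fin 3)} {θ₀ : ℝ} {c₀ : EuclideanSpace ℝ (Fin 3)}
    (hθ : Tendsto θ l (𝓝 θ₀)) (hc : Tendsto c l (𝓝 c₀)) :
    Tendsto (fun i => eLpNorm (fun x => u (rotZ (θ i) x + c i) - u (rotZ θ₀ x + c₀)) 3 volume)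
      l (𝓝 0) := by
  haveI : Fact (1 ≤ (3 : ℝ≥0∞)) := ⟨by norm_num⟩
  -- the motions as a continuous family of continuous maps
  let H : C((ℝ × EuclideanSpace ℝ (Fin 3)) × EuclideanSpace ℝ (Fin 3), EuclideanSpace ℝ (Fin 3)) :=
    ⟨fun q => rotZ q.1.1 q.2 + q.1.2, by
      refine Continuous.add ?_ (continuous_snd.comp continuous_fst)
      exact SereginZajaczkowski2007.continuous_rotZ_prod.comp ((continuous_fst.comp continuous_fst).prodMk continuous_snd)⟩
  have hH : ∀ (p : ℝ × EuclideanSpace ℝ (Fin 3)) (x : EuclideanSpace ℝ (Fin 3)), H.curry p x = rotZ p.1 x + p.2 := fun p x => rfl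
  have hmp : ∀ p : ℝ × EuclideanSpace ℝ (Fin 3), MeasurePreserving (H.curry p) volume volume := fun p => by
    have h1 : (H.curry p : EuclideanSpace ℝ (Fin 3) → EuclideanSpace ℝ (Fin 3)) = fun x => rotZ p.1 x + p.2 := funext (hH p)
    rw [h1]
    exact measurePreserving_motion p.1 p.2
  have hg : Tendsto (fun i => H.curry (θ i, c i)) l (𝓝 (H.curry (θ₀, c₀))) :=
    (H.curry.continuous.tendsto _).comp (hθ.prodMk_nhds hc)
  have hLp := Filter.Tendsto.compMeasurePreservingLp (μ := (volume : Measure (EuclideanSpace ℝ (Fin 3))))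
    (ν := (volume : Measure (EuclideanSpace ℝ (Fin 3)))) (E := EuclideanSpace ℝ (Fin 3)) (p := 3)
    (f := fun _ : ι => hu.toLp u) (f₀ := hu.toLp u) tendsto_const_nhds hg
    (fun i => hmp (θ i, c i)) (hmp (θ₀, c₀)) (by norm_num)
  rw [Lp.tendsto_Lp_iff_tendsto_eLpNorm'] at hLp
  refine hLp.congr fun i => eLpNorm_congr_ae ?_
  have h1 : (Lp.compMeasurePreserving (H.curry (θ i, c i)) (hmp (θ i, c i)) (hu.toLp u) : EuclideanSpace ℝ (Fin 3) → EuclideanSpace ℝ (Fin 3))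
      =ᵐ[volume] fun x => u (rotZ (θ i) x + c i) := by
    refine (Lp.coeFn_compMeasurePreserving _ _).trans ?_
    exact (hmp (θ i, c i)).quasiMeasurePreserving.ae_eq_comp hu.coeFn_toLp
  have h2 : (Lp.compMeasurePreserving (H.curry (θ₀, c₀)) (hmp (θ₀, c₀)) (hu.toLp u) : EuclideanSpace ℝ (Fin 3) → EuclideanSpace ℝ (Fin 3))
      =ᵐ[volume] fun x => u (rotZ θ₀ x + c₀) := by
    refine (Lp.coeFn_compMeasurePreserving _ _).trans ?_
    exact (hmp (θ₀, c₀)).quasiMeasurePreserving.ae_eq_comp hu.coeFn_toLp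
  filter_upwards [h1, h2] with x hx1 hx2
  simp only [Pi.sub_apply, hx1, hx2]

/-- **Continuity of the rotation action on values.** If `u ∈ L³` and `θ_i → θ₀` then
`‖R_{θ_i} ∘ u − R_{θ₀} ∘ u‖_{L³} → 0`. [folklore] -/
theorem tendsto_eLpNorm_rotZ_apply_sub {u : EuclideanSpace ℝ (Fin 3) → EuclideanSpace ℝ (Fin 3)} (hu : MemLp u 3 volume) {ι : Type*}
    {l : Filter ι} {θ : ι → ℝ} {θ₀ : ℝ} (hθ : Tendsto θ l (𝓝 θ₀)) :
    Tendsto (fun i => eLpNorm (fun x => rotZ (θ i) (u x) - rotZ θ₀ (u x)) 3 volume) l (𝓝 0) := by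
  set ε : ι → ℝ := fun i => |Real.cos (θ i) - Real.cos θ₀| + |Real.sin (θ i) - Real.sin θ₀| with hε
  have hε0 : Tendsto ε l (𝓝 0) := by
    have hc : Tendsto (fun i => |Real.cos (θ i) - Real.cos θ₀|) l (𝓝 0) := by
      have := ((Real.continuous_cos.tendsto θ₀).comp hθ).sub_const (Real.cos θ₀)
      simpa using this.abs
    have hs : Tendsto (fun i => |Real.sin (θ i) - Real.sin θ₀|) l (𝓝 0) := by
      have := ((Real.continuous_sin.tendsto θ₀).comp hθ).sub_const (Real.sin θ₀)
      simpa using this.abs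
    simpa using hc.add hs
  have hle : ∀ i, eLpNorm (fun x => rotZ (θ i) (u x) - rotZ θ₀ (u x)) 3 volume ≤
      ENNReal.ofReal (ε i) * eLpNorm u 3 volume := fun i =>
    eLpNorm_le_mul_eLpNorm_of_ae_le_mul
      (Eventually.of_forall fun x => DenseAngleClosure.norm_rotZ_sub_rotZ_le _ _ _) 3
  have hlim : Tendsto (fun i => ENNReal.ofReal (ε i) * eLpNorm u 3 volume) l (𝓝 0) := by
    have h1 : Tendsto (fun i => ENNReal.ofReal (ε i)) l (𝓝 0) := by
      simpa using ENNReal.tendsto_ofReal hε0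
    have := ENNReal.Tendsto.mul_const h1 (Or.inr hu.eLpNorm_lt_top.ne)
    simpa using this
  exact tendsto_of_tendsto_of_tendsto_of_le_of_le tendsto_const_nhds hlim (fun _ => zero_le) hle


/-- **Tails of an `L³` field over escaping balls vanish**: if `u ∈ L³` and `‖c_j‖ → ∞` then
`∫_{B(c_j, R)} ‖u‖³ → 0` (dominated convergence: the indicators tend to `0` pointwise). [folklore] -/
theorem tendsto_lintegral_ball_of_tendsto_norm_atTop {u : EuclideanSpace ℝ (Fin 3) → EuclideanSpace ℝ (Fin 3)} (hu : MemLp u 3 volume)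
    {c : ℕ → EuclideanSpace ℝ (Fin 3)} (hc : Tendsto (fun j => ‖c j‖) atTop atTop) (R : ℝ) :
    Tendsto (fun j => ∫⁻ x in Metric.ball (c j) R, ‖u x‖ₑ ^ (3 : ℝ)) atTop (𝓝 0) := by
  have hmeas : AEMeasurable (fun x => ‖u x‖ₑ ^ (3 : ℝ)) volume :=
    (hu.aestronglyMeasurable.aemeasurable.enorm.pow_const _)
  have hfin : ∫⁻ x, ‖u x‖ₑ ^ (3 : ℝ) ≠ ∞ := by
    have h := lintegral_rpow_enorm_lt_top_of_eLpNorm_lt_top (p := (3 : ℝ≥0∞)) (by norm_num)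
      (by norm_num) hu.eLpNorm_lt_top
    have h3 : (3 : ℝ≥0∞).toReal = 3 := by norm_num
    rw [h3] at h
    exact h.ne
  have hF : ∀ j, (∫⁻ x in Metric.ball (c j) R, ‖u x‖ₑ ^ (3 : ℝ)) =
      ∫⁻ x, (Metric.ball (c j) R).indicator (fun x => ‖u x‖ₑ ^ (3 : ℝ)) x :=
    fun j => (lintegral_indicator measurableSet_ball _).symm
  simp_rw [hF]
  rw [← lintegral_zero (μ := (volume : Measure (EuclideanSpace ℝ (Fin 3))))]
  refine tendsto_lintegral_of_dominated_convergence' (fun x => ‖u x‖ₑ ^ (3 : ℝ))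
    (fun j => hmeas.indicator measurableSet_ball)
    (fun j => Eventually.of_forall fun x => Set.indicator_le_self _ _ x) hfin
    (Eventually.of_forall fun x => ?_)
  -- eventually `x ∉ B(c_j, R)`
  have hev : ∀ᶠ j in atTop, (Metric.ball (c j) R).indicator (fun x => ‖u x‖ₑ ^ (3 : ℝ)) x = 0 := by
    filter_upwards [hc.eventually_gt_atTop (‖x‖ + R)] with j hj
    refine Set.indicator_of_notMem ?_ _
    rw [Metric.mem_ball, dist_eq_norm, not_lt]
    have h1 : ‖c j‖ ≤ ‖x - c j‖ + ‖x‖ := by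
      calc ‖c j‖ = ‖x - (x - c j)‖ := by rw [sub_sub_cancel]
        _ ≤ ‖x‖ + ‖x - c j‖ := norm_sub_le _ _
        _ = ‖x - c j‖ + ‖x‖ := add_comm _ _
    linarith
  exact tendsto_const_nhds.congr' (EventuallyEq.symm hev)

/-- The screw motion `x ↦ R_θ x + c` pulls the ball `B(c, R)` back to `B(0, R)`. [folklore] -/
theorem preimage_motion_ball (θ : ℝ) (c : EuclideanSpace ℝ (Fin 3)) (R : ℝ) :
    (fun x : EuclideanSpace ℝ (Fin 3) => rotZ θ x + c) ⁻¹' Metric.ball c R = Metric.ball 0 R := by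
  ext x
  simp [Metric.mem_ball, dist_eq_norm, norm_rotZ]

/-- **Escape lemma.** If `u ∈ L³(EuclideanSpace ℝ (Fin 3); EuclideanSpace ℝ (Fin 3))`, `‖c_j‖ → ∞`, and `‖u(R_{θ_j} · + c_j) − u‖_{L³} → 0`, then
`u = 0` in `L³`: the `L³`-mass of `u` in `B(0, R)` equals, up to `‖u ∘ A_j − u‖_{L³}`, the mass of
`u` in the escaping ball `B(c_j, R)`, which tends to `0`. [folklore] -/
theorem eLpNorm_eq_zero_of_tendsto_eLpNorm_comp_motion_sub {u : EuclideanSpace ℝ (Fin 3) → EuclideanSpace ℝ (Fin 3)} (hu : MemLp u 3 volume)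
    {θ : ℕ → ℝ} {c : ℕ → EuclideanSpace ℝ (Fin 3)} (hc : Tendsto (fun j => ‖c j‖) atTop atTop)
    (h : Tendsto (fun j => eLpNorm (fun x => u (rotZ (θ j) x + c j) - u x) 3 volume) atTop (𝓝 0)) :
    eLpNorm u 3 volume = 0 := by
  -- Step 1: `u` has no mass in any ball about the origin
  have hball : ∀ R : ℝ, eLpNorm u 3 (volume.restrict (Metric.ball (0 : EuclideanSpace ℝ (Fin 3)) R)) = 0 := by
    intro R
    set A : ℕ → EuclideanSpace ℝ (Fin 3) → EuclideanSpace ℝ (Fin 3) := fun j x => rotZ (θ j) x + c j with hA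
    have hmp : ∀ j, MeasurePreserving (A j) volume volume := fun j => measurePreserving_motion (θ j) (c j)
    have hmpR : ∀ j, MeasurePreserving (A j) (volume.restrict (Metric.ball (0 : EuclideanSpace ℝ (Fin 3)) R))
        (volume.restrict (Metric.ball (c j) R)) := fun j => by
      have h1 := (hmp j).restrict_preimage (measurableSet_ball (x := c j) (ε := R))
      rwa [show A j ⁻¹' Metric.ball (c j) R = Metric.ball 0 R from preimage_motion_ball _ _ _] at h1
    have heq : ∀ j, eLpNorm (u ∘ A j) 3 (volume.restrict (Metric.ball (0 : EuclideanSpace ℝ (Fin 3)) R)) =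
        eLpNorm u 3 (volume.restrict (Metric.ball (c j) R)) := fun j =>
      eLpNorm_comp_measurePreserving hu.aestronglyMeasurable.restrict (hmpR j)
    have huA : ∀ j, AEStronglyMeasurable (u ∘ A j) volume := fun j =>
      hu.aestronglyMeasurable.comp_measurePreserving (hmp j)
    -- triangle inequality on the ball
    have htri : ∀ j, eLpNorm u 3 (volume.restrict (Metric.ball (0 : EuclideanSpace ℝ (Fin 3)) R)) ≤
        eLpNorm (fun x => u (rotZ (θ j) x + c j) - u x) 3 volume +
          eLpNorm u 3 (volume.restrict (Metric.ball (c j) R)) := fun j => by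
      have hsplit : u = (u - u ∘ A j) + u ∘ A j := by simp
      calc eLpNorm u 3 (volume.restrict (Metric.ball (0 : EuclideanSpace ℝ (Fin 3)) R))
          = eLpNorm ((u - u ∘ A j) + u ∘ A j) 3 (volume.restrict (Metric.ball (0 : EuclideanSpace ℝ (Fin 3)) R)) := by
            rw [← hsplit]
        _ ≤ eLpNorm (u - u ∘ A j) 3 (volume.restrict (Metric.ball (0 : EuclideanSpace ℝ (Fin 3)) R)) +
              eLpNorm (u ∘ A j) 3 (volume.restrict (Metric.ball (0 : EuclideanSpace ℝ (Fin 3)) R)) :=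
            eLpNorm_add_le (hu.aestronglyMeasurable.sub (huA j)).restrict (huA j).restrict
              (by norm_num)
        _ ≤ eLpNorm (u - u ∘ A j) 3 volume + eLpNorm u 3 (volume.restrict (Metric.ball (c j) R)) := by
            rw [heq j]
            exact add_le_add (eLpNorm_mono_measure _ Measure.restrict_le_self) le_rfl
        _ = _ := by
            rw [eLpNorm_sub_comm]
            rfl
    -- the far mass tends to zero
    have hfar : Tendsto (fun j => eLpNorm u 3 (volume.restrict (Metric.ball (c j) R))) atTop (𝓝 0) := by
      have h3 : ∀ j, eLpNorm u 3 (volume.restrict (Metric.ball (c j) R)) =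
          (∫⁻ x in Metric.ball (c j) R, ‖u x‖ₑ ^ (3 : ℝ)) ^ (1 / (3 : ℝ)) := fun j => by
        rw [eLpNorm_eq_lintegral_rpow_enorm_toReal (by norm_num) (by norm_num)]
        norm_num
      simp_rw [h3]
      have h0 : (0 : ℝ≥0∞) = 0 ^ (1 / (3 : ℝ)) := by rw [ENNReal.zero_rpow_of_pos (by norm_num)]
      rw [h0]
      exact (ENNReal.continuous_rpow_const.tendsto 0).comp
        (tendsto_lintegral_ball_of_tendsto_norm_atTop hu hc R)
    have hsum := h.add hfar
    rw [add_zero] at hsum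
    exact le_antisymm (ge_of_tendsto' hsum htri) (zero_le)
  -- Step 2: hence `u = 0` a.e.
  have hae : ∀ n : ℕ, ∀ᵐ x ∂(volume.restrict (Metric.ball (0 : EuclideanSpace ℝ (Fin 3)) n)), u x = 0 := fun n => by
    have h0 := (eLpNorm_eq_zero_iff hu.aestronglyMeasurable.restrict (by norm_num)).1 (hball n)
    filter_upwards [h0] with x hx
    simpa using hx
  have hae' : u =ᵐ[volume] 0 := by
    have h1 := (ae_restrict_iUnion_iff (μ := (volume : Measure (EuclideanSpace ℝ (Fin 3))))
      (fun n : ℕ => Metric.ball (0 : EuclideanSpace ℝ (Fin 3)) n) (fun x => u x = 0)).2 hae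
    rw [Metric.iUnion_ball_nat, Measure.restrict_univ] at h1
    exact h1
  rw [eLpNorm_congr_ae hae', eLpNorm_zero]

/-- **Periodic `L³` fields vanish**: if `u ∈ L³(EuclideanSpace ℝ (Fin 3); EuclideanSpace ℝ (Fin 3))` and `u(· + c₀) = u` a.e. for some
`c₀ ≠ 0`, then `u = 0` in `L³` (iterate the period and let the mass escape,
`eLpNorm_eq_zero_of_tendsto_eLpNorm_comp_motion_sub`). [folklore] -/
theorem eLpNorm_eq_zero_of_translate_ae_eq {u : EuclideanSpace ℝ (Fin 3) → EuclideanSpace ℝ (Fin 3)} (hu : MemLp u 3 volume) {c₀ : EuclideanSpace ℝ (Fin 3)}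
    (hc₀ : c₀ ≠ 0) (h : (fun x => u (x + c₀)) =ᵐ[volume] u) : eLpNorm u 3 volume = 0 := by
  -- all natural multiples of `c₀` are periods
  have hk : ∀ k : ℕ, (fun x => u (x + (k : ℝ) • c₀)) =ᵐ[volume] u := by
    intro k
    induction k with
    | zero => exact Eventually.of_forall fun x => by simp
    | succ k ih =>
      have h1 : (fun x => u ((x + c₀) + (k : ℝ) • c₀)) =ᵐ[volume] fun x => u (x + c₀) :=
        (measurePreserving_add_right volume c₀).quasiMeasurePreserving.ae_eq_comp ih
      have h2 : (fun x => u (x + ((k + 1 : ℕ) : ℝ) • c₀)) = fun x => u ((x + c₀) + (k : ℝ) • c₀) := by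
        funext x
        congr 1
        rw [Nat.cast_succ, add_smul, one_smul, add_assoc, add_comm c₀]
      rw [h2]
      exact h1.trans h
  refine eLpNorm_eq_zero_of_tendsto_eLpNorm_comp_motion_sub hu (θ := fun _ => 0)
    (c := fun j => (j : ℝ) • c₀) ?_ ?_
  · have h1 : (fun j : ℕ => ‖(j : ℝ) • c₀‖) = fun j : ℕ => (j : ℝ) * ‖c₀‖ := by
      funext j
      rw [norm_smul, Real.norm_of_nonneg (Nat.cast_nonneg j)]
    rw [h1]
    exact tendsto_natCast_atTop_atTop.atTop_mul_const (norm_pos_iff.2 hc₀)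
  · refine tendsto_const_nhds.congr fun j => ?_
    have h1 : (fun x => u (rotZ 0 x + (j : ℝ) • c₀) - u x) =ᵐ[volume] (0 : EuclideanSpace ℝ (Fin 3) → EuclideanSpace ℝ (Fin 3)) := by
      filter_upwards [hk j] with x hx
      simp only [rotZ_zero, Pi.zero_apply, sub_eq_zero]
      exact hx
    rw [eLpNorm_congr_ae h1, eLpNorm_zero]

/-- **Almost-invariance under motions with non-vanishing translation forces `u = 0`.** Let
`u ∈ L³(EuclideanSpace ℝ (Fin 3); EuclideanSpace ℝ (Fin 3))`, `θ_j → 0`, `‖c_j‖ ≥ η > 0`, and `‖u(R_{θ_j} · + c_j) − u‖_{L³} → 0`. Then `u = 0`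
in `L³`: either `‖c_j‖ → ∞` along a subsequence (escape lemma), or `c_j → c₀ ≠ 0` along a
subsequence, and then `u(· + c₀) = u` a.e. (strong continuity of the action), so `u` is periodic
and vanishes. [folklore] -/
theorem eLpNorm_eq_zero_of_tendsto_motion_of_norm_ge {u : EuclideanSpace ℝ (Fin 3) → EuclideanSpace ℝ (Fin 3)} (hu : MemLp u 3 volume)
    {θ : ℕ → ℝ} {c : ℕ → EuclideanSpace ℝ (Fin 3)} (hθ : Tendsto θ atTop (𝓝 0)) {η : ℝ} (hη : 0 < η)
    (hc : ∀ j, η ≤ ‖c j‖)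
    (h : Tendsto (fun j => eLpNorm (fun x => u (rotZ (θ j) x + c j) - u x) 3 volume) atTop (𝓝 0)) :
    eLpNorm u 3 volume = 0 := by
  have hcpos : ∀ j, 0 < ‖c j‖ := fun j => hη.trans_le (hc j)
  -- normalise: `s_j = ‖c_j‖⁻¹ ∈ (0, η⁻¹]`, `d_j = s_j • c_j` a unit vector; extract a limit
  set s : ℕ → ℝ := fun j => ‖c j‖⁻¹ with hs
  set d : ℕ → EuclideanSpace ℝ (Fin 3) := fun j => s j • c j with hd
  have hspos : ∀ j, 0 < s j := fun j => inv_pos.2 (hcpos j)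
  have hsle : ∀ j, s j ≤ η⁻¹ := fun j => by
    rw [hs]
    exact inv_anti₀ hη (hc j)
  have hdn : ∀ j, ‖d j‖ = 1 := fun j => by
    rw [hd, hs]
    simp only [norm_smul, norm_inv, norm_norm]
    exact inv_mul_cancel₀ (hcpos j).ne'
  have hmem : ∀ j, (s j, d j) ∈ Metric.closedBall (0 : ℝ × EuclideanSpace ℝ (Fin 3)) (max η⁻¹ 1) := fun j => by
    rw [mem_closedBall_zero_iff, Prod.norm_mk, Real.norm_of_nonneg (hspos j).le, hdn j]
    exact max_le_max (hsle j) le_rfl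
  obtain ⟨⟨s₀, d₀⟩, -, ψ, hψ, hlim⟩ := tendsto_subseq_of_bounded Metric.isBounded_closedBall hmem
  have hs₀ : Tendsto (fun j => s (ψ j)) atTop (𝓝 s₀) := (continuous_fst.tendsto _).comp hlim
  have hd₀ : Tendsto (fun j => d (ψ j)) atTop (𝓝 d₀) := (continuous_snd.tendsto _).comp hlim
  have hψt : Tendsto ψ atTop atTop := hψ.tendsto_atTop
  rcases eq_or_ne s₀ 0 with hs0 | hs0
  · -- `‖c_{ψ j}‖ → ∞`: escape
    have hs' : Tendsto (fun j => s (ψ j)) atTop (𝓝[>] 0) := by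
      rw [hs0] at hs₀
      exact tendsto_nhdsWithin_iff.2 ⟨hs₀, Eventually.of_forall fun j => hspos (ψ j)⟩
    have hnorm : Tendsto (fun j => ‖c (ψ j)‖) atTop atTop := by
      have h1 := tendsto_inv_nhdsGT_zero.comp hs'
      refine h1.congr fun j => ?_
      simp [hs]
    exact eLpNorm_eq_zero_of_tendsto_eLpNorm_comp_motion_sub hu hnorm (h.comp hψt)
  · -- `c_{ψ j} → c₀ ≠ 0`: periodicity
    set c₀ : EuclideanSpace ℝ (Fin 3) := s₀⁻¹ • d₀ with hc₀
    have hd₀n : ‖d₀‖ = 1 := by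
      have h1 := (continuous_norm.tendsto _).comp hd₀
      have h2 : (fun j => ‖d (ψ j)‖) = fun _ => (1 : ℝ) := funext fun j => hdn (ψ j)
      rw [show ((fun x => ‖x‖) ∘ fun j => d (ψ j)) = fun j => ‖d (ψ j)‖ from rfl, h2] at h1
      exact tendsto_nhds_unique h1 tendsto_const_nhds
    have hc₀ne : c₀ ≠ 0 := by
      rw [hc₀, smul_ne_zero_iff]
      exact ⟨inv_ne_zero hs0, fun h0 => by simp [h0] at hd₀n⟩
    have hclim : Tendsto (fun j => c (ψ j)) atTop (𝓝 c₀) := by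
      have h1 : (fun j => c (ψ j)) = fun j => (s (ψ j))⁻¹ • d (ψ j) := by
        funext j
        rw [hd]
        simp only [smul_smul, inv_mul_cancel₀ (hspos (ψ j)).ne', one_smul]
      rw [h1, hc₀]
      exact (hs₀.inv₀ hs0).smul hd₀
    -- `‖u(· + c₀) − u‖ ≤ ‖u ∘ A_{ψ j} − u(· + c₀)‖ + ‖u ∘ A_{ψ j} − u‖ → 0`
    have hT := tendsto_eLpNorm_comp_motion_sub hu (hθ.comp hψt) hclim
    have hmeas : ∀ (a : ℝ) (b : EuclideanSpace ℝ (Fin 3)), AEStronglyMeasurable (fun x => u (rotZ a x + b)) volume :=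
      fun a b => hu.aestronglyMeasurable.comp_measurePreserving (measurePreserving_motion a b)
    have hle : ∀ j, eLpNorm (fun x => u (x + c₀) - u x) 3 volume ≤
        eLpNorm (fun x => u (rotZ (θ (ψ j)) x + c (ψ j)) - u (rotZ 0 x + c₀)) 3 volume +
          eLpNorm (fun x => u (rotZ (θ (ψ j)) x + c (ψ j)) - u x) 3 volume := fun j => by
      have hsplit : (fun x => u (x + c₀) - u x) =
          (fun x => u (rotZ 0 x + c₀) - u (rotZ (θ (ψ j)) x + c (ψ j))) +
            fun x => u (rotZ (θ (ψ j)) x + c (ψ j)) - u x := by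
        funext x
        simp only [Pi.add_apply, rotZ_zero, sub_add_sub_cancel]
      rw [hsplit]
      refine (eLpNorm_add_le ((hmeas _ _).sub (hmeas _ _)) ((hmeas _ _).sub hu.aestronglyMeasurable)
        (by norm_num)).trans (le_of_eq ?_)
      congr 1
      exact eLpNorm_sub_comm (fun x => u (rotZ 0 x + c₀)) (fun x => u (rotZ (θ (ψ j)) x + c (ψ j))) 3 volume
    have hsum := hT.add (h.comp hψt)
    rw [add_zero] at hsum
    have h0 : eLpNorm (fun x => u (x + c₀) - u x) 3 volume = 0 :=
      le_antisymm (ge_of_tendsto' hsum hle) zero_le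
    have hae : (fun x => u (x + c₀)) =ᵐ[volume] u := by
      have h1 := (eLpNorm_eq_zero_iff (((hmeas 0 c₀).congr (Eventually.of_forall fun x => by
        simp only [rotZ_zero])).sub hu.aestronglyMeasurable) (by norm_num)).1 h0
      filter_upwards [h1] with x hx
      simpa [sub_eq_zero] using hx
    exact eLpNorm_eq_zero_of_translate_ae_eq hu hc₀ne hae

/-- **Registered helper stub `stub_motionRigidity`** (crux stmt-NavierStokesRegularity-15454, line
`birth`; the statement of `eLpNorm_eq_zero_of_tendsto_motion_of_norm_ge` with the rotation written
out in coordinates, as in the route file): an `L³` field almost invariant under screw motions with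
rotation angles `θ_j → 0` and translations of length `≥ η > 0` is zero. [folklore] -/
theorem stub_motionRigidity :
    ∀ (u : EuclideanSpace ℝ (Fin 3) → EuclideanSpace ℝ (Fin 3)) (θ : ℕ → ℝ) (c : ℕ → EuclideanSpace ℝ (Fin 3)) (η : ℝ), MemLp u 3 volume → Tendsto θ atTop (𝓝 0) → 0 < η → (∀ j, η ≤ ‖c j‖) → Tendsto (fun j => eLpNorm (fun x : EuclideanSpace ℝ (Fin 3) => u (WithLp.toLp 2 ![Real.cos (θ j) * x 0 - Real.sin (θ j) * x 1, Real.sin (θ j) * x 0 + Real.cos (θ j) * x 1, x 2] + c j) - u x) 3 volume) atTop (𝓝 0) → eLpNorm u 3 volume = 0 :=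
  fun _u _θ _c _η hu hθ hη hc h => eLpNorm_eq_zero_of_tendsto_motion_of_norm_ge hu hθ hη hc h

end Summit.NavierStokesRegularity.NavierStokesRegularity.Theorems.PFoldToAxisymmetric.AxisPinning

end
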